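import Literature.NumberTheory.BeurlingPrimes.WellBehavedSystems
import Mathlib.MeasureTheory.Integral.Bochner.Set
import Mathlib.Analysis.SpecialFunctions.Trigonometric.Bounds
import Mathlib.Analysis.SpecialFunctions.Complex.Log
import HarnessLib

/-!
# Broucke–Vindas 2024, Theorem 1.2 — I. Phases and the quantile transform

Topic `Literature/NumberTheory/BeurlingPrimes`, grouping namespace `BrouckeVindas` (Broucke–Vindas 2024, §2,
proof of Theorem 1.2 = the named fact `BrouckeVindas2024_thm12` of `WellBehavedSystems.lean`). Everything in
this file is PROVED; it introduces no definitions (the construction is carried by hypotheses on an abstract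
generalized inverse `G`, instantiated in `exists_galois`).

BV §2 discretise a non-decreasing right-continuous `F` (`F(1) = 0`, `F → ∞`) by independent random primes
`P_j` distributed on `(q_{j−1}, q_j]`, `q_j = min{x : F_c(x) = j}`, according to `dF_c` (continuous part), plus
a modified scheme for the atomic part. Both are realised at once by a **quantile coupling**: a function `G`
with the Galois property `G(s) ≤ y ↔ s ≤ F(y)` (`s > 0`) — e.g. `G(s) = inf{y : s ≤ F(y)}` (`exists_galois`) —
transports Lebesgue measure on `(0, ∞)` to `dF` (`measure_eq_map`), so that
`∫_{[1,x]} u^{−it} dF(u) = ∫_{(0,F(x)]} G(s)^{−it} ds` (`stieltjesExpSum_eq_integral`) and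
`Σ_{j<n} ∫_{(0,1]} G(j+u)^{−it} du = ∫_{(0,n]} G(s)^{−it} ds` (`sum_integral_cpow_comp`). This file also
collects the elementary facts on the phases `a^{−it} = (a : ℂ)^{−ti}`: `|a^{−it} − a^{−it'}| ≤ |t − t'| log a`
(`norm_cpow_negI_sub_le`, used instead of BV's partial summation in `t`) and `a^{it} = conj a^{−it}`.
Parts II–IV: `WellBehavedSystemsCoupling.lean` (the coupled prime system `p_j = G(j + ω_j)`),
`WellBehavedSystemsRandom.lean` (Hoeffding + union bound), `WellBehavedSystemsProofs.lean` (assembly).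

## References
* [BrouckeVindas2024] F. Broucke, J. Vindas, *A new generalized prime random approximation procedure and some of
  its applications*, Math. Z. 307 (2024), arXiv:2102.08478, §2 (proof of Theorem 1.2) (read).
-/

noncomputable section

open Complex Filter MeasureTheory Set
open scoped Topology ComplexConjugate

namespace Literature.NumberTheory.BeurlingPrimes

open Literature.Barriers.RiemannHypothesis

namespace BrouckeVindas

/-! ### Phases `a^{−it}` -/

/-- `a^{−it} = exp(−it log a)` for `a > 0`. [folklore] -/
theorem cpow_negI_eq_exp {a : ℝ} (ha : 0 < a) (t : ℝ) :
    ((a : ℂ)) ^ (-(t * I)) = Complex.exp (((-(t * Real.log a) : ℝ) : ℂ) * I) := by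
  rw [cpow_def_of_ne_zero (ofReal_ne_zero.2 ha.ne'), ← ofReal_log ha.le]
  congr 1
  push_cast
  ring

/-- `|Re a^{−it}| ≤ 1` for `a > 0`. [folklore] -/
theorem abs_re_cpow_negI_le {a : ℝ} (ha : 0 < a) (t : ℝ) : |(((a : ℂ)) ^ (-(t * I))).re| ≤ 1 :=
  (abs_re_le_norm _).trans (norm_cpow_neg_mul_I ha t).le

/-- `|Im a^{−it}| ≤ 1` for `a > 0`. [folklore] -/
theorem abs_im_cpow_negI_le {a : ℝ} (ha : 0 < a) (t : ℝ) : |(((a : ℂ)) ^ (-(t * I))).im| ≤ 1 :=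
  (abs_im_le_norm _).trans (norm_cpow_neg_mul_I ha t).le

/-- `a^{−i(−t)} = conj(a^{−it})` for `a > 0`. [folklore] -/
theorem cpow_negI_neg {a : ℝ} (ha : 0 < a) (t : ℝ) :
    ((a : ℂ)) ^ (-(((-t : ℝ) : ℂ) * I)) = conj (((a : ℂ)) ^ (-(t * I))) := by
  rw [cpow_negI_eq_exp ha, cpow_negI_eq_exp ha, ← Complex.exp_conj]
  congr 1
  simp only [map_mul, Complex.conj_ofReal, Complex.conj_I]
  push_cast
  ring

/-- `‖a^{−it} − a^{−it'}‖ ≤ |t − t'| log a` for `a ≥ 1`. [folklore] -/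
theorem norm_cpow_negI_sub_le {a : ℝ} (ha : 1 ≤ a) (t t' : ℝ) :
    ‖((a : ℂ)) ^ (-(t * I)) - ((a : ℂ)) ^ (-(t' * I))‖ ≤ |t - t'| * Real.log a := by
  have ha0 : 0 < a := one_pos.trans_le ha
  rw [cpow_negI_eq_exp ha0, cpow_negI_eq_exp ha0]
  set θ : ℝ := -(t * Real.log a) with hθ
  set θ' : ℝ := -(t' * Real.log a) with hθ'
  have h : Complex.exp ((θ : ℂ) * I) - Complex.exp ((θ' : ℂ) * I) =
      Complex.exp ((θ' : ℂ) * I) * (Complex.exp (I * ((θ - θ' : ℝ) : ℂ)) - 1) := by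
    rw [mul_sub, mul_one, ← Complex.exp_add]
    congr 2
    push_cast
    ring
  rw [h, norm_mul, norm_exp_ofReal_mul_I, one_mul]
  calc ‖Complex.exp (I * ((θ - θ' : ℝ) : ℂ)) - 1‖ ≤ ‖θ - θ'‖ := Real.norm_exp_I_mul_ofReal_sub_one_le
    _ = |t - t'| * Real.log a := by
      rw [Real.norm_eq_abs, hθ, hθ', show -(t * Real.log a) - -(t' * Real.log a) = -((t - t') * Real.log a) by ring,
        abs_neg, abs_mul, abs_of_nonneg (Real.log_nonneg ha)]

/-- `a ↦ a^{−it}` is measurable. [folklore] -/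
theorem measurable_cpow_negI (t : ℝ) : Measurable fun a : ℝ ↦ ((a : ℂ)) ^ (-(t * I)) :=
  (Complex.measurable_ofReal.comp measurable_id).pow_const _

/-! ### A generalized inverse `G` of `F`: consequences of the Galois property -/

section Galois

variable {F : StieltjesFunction ℝ} {G : ℝ → ℝ}
variable (h1 : F 1 = 0) (hG : ∀ ⦃s : ℝ⦄, 0 < s → ∀ y : ℝ, G s ≤ y ↔ s ≤ F y)
include hG

/-- `s ≤ F(G(s))` for `s > 0`. [cite: BrouckeVindas2024, §2 ("q_j = min{x : F_c(x) = j}")] -/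
theorem le_apply_of_galois {s : ℝ} (hs : 0 < s) : s ≤ F (G s) := (hG hs _).1 le_rfl

/-- `y < G(s) ↔ F(y) < s` for `s > 0`. [cite: BrouckeVindas2024, §2] -/
theorem lt_iff_of_galois {s : ℝ} (hs : 0 < s) {y : ℝ} : y < G s ↔ F y < s := by
  rw [← not_le, hG hs, not_le]

include h1 in
/-- `G(s) > 1` for `s > 0` when `F(1) = 0`. [cite: BrouckeVindas2024, §2] -/
theorem one_lt_of_galois {s : ℝ} (hs : 0 < s) : 1 < G s :=
  (lt_iff_of_galois hG hs).2 (by rw [h1]; exact hs)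

/-- `G(n) → ∞` along the integers. [cite: BrouckeVindas2024, §2] -/
theorem tendsto_natCast_of_galois : Tendsto (fun n : ℕ ↦ G n) atTop atTop := by
  refine tendsto_atTop_atTop.2 fun y ↦ ?_
  obtain ⟨n, hn⟩ := exists_nat_gt (max (F y) 0)
  refine ⟨n, fun m hm ↦ ?_⟩
  have hm' : max (F y) 0 < (m : ℝ) := hn.trans_le (by exact_mod_cast hm)
  have hm0 : (0 : ℝ) < m := (le_max_right _ _).trans_lt hm'
  exact ((lt_iff_of_galois hG hm0).2 ((le_max_left _ _).trans_lt hm')).le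

/-- `G` is strictly increasing on `(0, ∞)` when `F` is continuous (and `G` is monotone).
[cite: BrouckeVindas2024, Theorem 1.2 ("the sequence 𝒫 can be chosen to be (strictly) increasing")] -/
theorem lt_of_galois_of_continuous (hGm : Monotone G) (hc : Continuous fun x : ℝ ↦ F x) {s s' : ℝ}
    (hs : 0 < s) (hss' : s < s') : G s < G s' := by
  by_contra h
  have heq : G s' = G s := le_antisymm (not_lt.1 h) (hGm hss'.le)
  set y := G s with hy
  have hy' : s' ≤ F y := heq ▸ le_apply_of_galois hG (hs.trans hss')
  have hev : ∀ᶠ y' in 𝓝 y, s < F y' := (hc.tendsto y).eventually_const_lt (hss'.trans_le hy')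
  have hev' : ∀ᶠ y' in 𝓝[<] y, s < F y' ∧ y' < y :=
    (hev.filter_mono nhdsWithin_le_nhds).and self_mem_nhdsWithin
  obtain ⟨y', hsy', hy'y⟩ := hev'.exists
  have : F y' < s := (lt_iff_of_galois hG hs).1 hy'y
  linarith

/-- `G^{-1}((a, b]) ∩ (0, ∞) = (F(a), F(b)]` when `F ≥ 0`. [cite: BrouckeVindas2024, §2] -/
theorem preimage_Ioc_inter_Ioi (h0 : ∀ x, 0 ≤ F x) (a b : ℝ) :
    G ⁻¹' Ioc a b ∩ Ioi 0 = Ioc (F a) (F b) := by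
  ext s
  simp only [mem_inter_iff, mem_preimage, mem_Ioc, mem_Ioi]
  constructor
  · rintro ⟨⟨has, hsb⟩, hs⟩
    exact ⟨(lt_iff_of_galois hG hs).1 has, (hG hs _).1 hsb⟩
  · rintro ⟨has, hsb⟩
    have hs : 0 < s := (h0 a).trans_lt has
    exact ⟨⟨(lt_iff_of_galois hG hs).2 has, (hG hs _).2 hsb⟩, hs⟩

/-- **Change of variables**: `dF` is the push-forward of Lebesgue measure on `(0, ∞)` under `G`
(`F ≥ 0`; `G` monotone). [cite: BrouckeVindas2024, §2 ("P_j is distributed … according to dF_c|_{(q_{j−1},q_j]}")] -/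
theorem measure_eq_map (hGm : Monotone G) (h0 : ∀ x, 0 ≤ F x) :
    F.measure = (volume.restrict (Ioi (0 : ℝ))).map G := by
  refine Measure.ext_of_Ioc' _ _ (fun a b _ ↦ by rw [F.measure_Ioc]; exact ENNReal.ofReal_ne_top)
    fun a b _ ↦ ?_
  rw [F.measure_Ioc, Measure.map_apply hGm.measurable measurableSet_Ioc,
    Measure.restrict_apply (measurableSet_Ioc.preimage hGm.measurable),
    preimage_Ioc_inter_Ioi hG h0, Real.volume_Ioc]

/-- `G^{-1}([1, y]) ∩ (0, ∞) = (0, F(y)]` when `G ≥ 1`. [cite: BrouckeVindas2024, §2] -/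
theorem preimage_Icc_one_inter_Ioi (hG1 : ∀ s, 1 ≤ G s) (y : ℝ) :
    G ⁻¹' Icc 1 y ∩ Ioi 0 = Ioc 0 (F y) := by
  ext s
  simp only [mem_inter_iff, mem_preimage, mem_Icc, mem_Ioc, mem_Ioi]
  constructor
  · rintro ⟨⟨_, hsy⟩, hs⟩
    exact ⟨hs, (hG hs _).1 hsy⟩
  · rintro ⟨hs, hsy⟩
    exact ⟨⟨hG1 s, (hG hs _).2 hsy⟩, hs⟩

/-- **The Stieltjes exponential integral through the quantile**:
`∫_{[1,y]} u^{−it} dF(u) = ∫_{(0, F(y)]} G(s)^{−it} ds`. [cite: BrouckeVindas2024, §2] -/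
theorem stieltjesExpSum_eq_integral (hGm : Monotone G) (hG1 : ∀ s, 1 ≤ G s) (h0 : ∀ x, 0 ≤ F x) (y t : ℝ) :
    stieltjesExpSum F y t = ∫ s in Ioc 0 (F y), ((G s : ℂ)) ^ (-(t * I)) := by
  unfold stieltjesExpSum
  rw [measure_eq_map hG hGm h0]
  rw [setIntegral_map measurableSet_Icc (measurable_cpow_negI t).aestronglyMeasurable hGm.measurable.aemeasurable,
    Measure.restrict_restrict (measurableSet_Icc.preimage hGm.measurable), preimage_Icc_one_inter_Ioi hG hG1 y]

end Galois

/-! ### Integrals of `s ↦ G(s)^{−it}` -/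

section Integrals

variable {G : ℝ → ℝ} (hGm : Monotone G) (hG1 : ∀ s, 1 ≤ G s)
include hGm hG1

omit hGm in
/-- `‖G(s)^{−it}‖ = 1`. [cite: BrouckeVindas2024, §2] -/
theorem norm_cpow_comp (s t : ℝ) : ‖((G s : ℂ)) ^ (-(t * I))‖ = 1 :=
  norm_cpow_neg_mul_I (one_pos.trans_le (hG1 s)) t

/-- `s ↦ G(c + s)^{−it}` is integrable on every set of finite Lebesgue measure. [cite: BrouckeVindas2024, §2] -/
theorem integrableOn_cpow_comp_add (c t : ℝ) {A : Set ℝ} (hA : volume A < ⊤) :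
    IntegrableOn (fun s : ℝ ↦ ((G (c + s) : ℂ)) ^ (-(t * I))) A volume := by
  refine Integrable.mono' (g := fun _ ↦ (1 : ℝ)) (integrableOn_const hA.ne) ?_ (Eventually.of_forall fun s ↦ ?_)
  · exact (((measurable_cpow_negI t).comp hGm.measurable).comp (measurable_const_add c)).aestronglyMeasurable
  · exact (norm_cpow_comp hG1 (c + s) t).le

/-- `s ↦ G(s)^{−it}` is integrable on every set of finite Lebesgue measure. [cite: BrouckeVindas2024, §2] -/
theorem integrableOn_cpow_comp (t : ℝ) {A : Set ℝ} (hA : volume A < ⊤) :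
    IntegrableOn (fun s : ℝ ↦ ((G s : ℂ)) ^ (-(t * I))) A volume := by
  have h := integrableOn_cpow_comp_add hGm hG1 0 t hA
  simp only [zero_add] at h
  exact h

omit hGm in
/-- `‖∫_A G(s)^{−it} ds‖ ≤ |A|`. [cite: BrouckeVindas2024, §2] -/
theorem norm_integral_cpow_comp_le (t : ℝ) {A : Set ℝ} (hA : volume A < ⊤) :
    ‖∫ s in A, ((G s : ℂ)) ^ (-(t * I))‖ ≤ volume.real A := by
  have h := norm_setIntegral_le_of_norm_le_const hA (f := fun s : ℝ ↦ ((G s : ℂ)) ^ (-(t * I))) (C := 1)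
    fun s _ ↦ (norm_cpow_comp hG1 s t).le
  simpa using h

/-- **Adjacent unit intervals**: `Σ_{j<n} ∫_{(0,1]} G(j+u)^{−it} du = ∫_{(0,n]} G(s)^{−it} ds`.
[cite: BrouckeVindas2024, §2] -/
theorem sum_integral_cpow_comp (t : ℝ) (n : ℕ) :
    ∑ j ∈ Finset.range n, ∫ u in Ioc (0 : ℝ) 1, ((G (j + u) : ℂ)) ^ (-(t * I)) =
      ∫ s in Ioc (0 : ℝ) n, ((G s : ℂ)) ^ (-(t * I)) := by
  have key : ∀ j : ℕ, ∫ u in Ioc (0 : ℝ) 1, ((G (j + u) : ℂ)) ^ (-(t * I)) =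
      ∫ s in ((j : ℕ) : ℝ)..((j + 1 : ℕ) : ℝ), ((G s : ℂ)) ^ (-(t * I)) := by
    intro j
    rw [← intervalIntegral.integral_of_le zero_le_one,
      intervalIntegral.integral_comp_add_left (fun s ↦ ((G s : ℂ)) ^ (-(t * I))) (j : ℝ)]
    simp
  rw [Finset.sum_congr rfl fun j _ ↦ key j, intervalIntegral.sum_integral_adjacent_intervals]
  · rw [Nat.cast_zero, intervalIntegral.integral_of_le (Nat.cast_nonneg n)]
  · intro k _
    rw [intervalIntegrable_iff_integrableOn_Ioc_of_le (by exact_mod_cast Nat.le_succ k)]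
    exact integrableOn_cpow_comp hGm hG1 t (by simp)

/-- `∫_{(0, m]} = ∫_{(0, n]} + ∫_{(n, m]}` for `n ≤ m`. [cite: BrouckeVindas2024, §2] -/
theorem integral_Ioc_eq_add {n : ℕ} {m : ℝ} (hn : (n : ℝ) ≤ m) (t : ℝ) :
    ∫ s in Ioc 0 m, ((G s : ℂ)) ^ (-(t * I)) =
      (∫ s in Ioc (0 : ℝ) n, ((G s : ℂ)) ^ (-(t * I))) + ∫ s in Ioc (n : ℝ) m, ((G s : ℂ)) ^ (-(t * I)) := by
  rw [← Ioc_union_Ioc_eq_Ioc (Nat.cast_nonneg n) hn,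
    setIntegral_union (Ioc_disjoint_Ioc_of_le le_rfl) measurableSet_Ioc
      (integrableOn_cpow_comp hGm hG1 t (by simp)) (integrableOn_cpow_comp hGm hG1 t (by simp))]

end Integrals

/-! ### Existence of a generalized inverse -/

/-- **The quantile function exists**: for `F(1) = 0` and `F → ∞` there is a monotone `G ≥ 1` with
`G(s) ≤ y ↔ s ≤ F(y)` for all `s > 0`, namely `G(s) = inf{y : s ≤ F(y)}` (`s > 0`; `G = 1` on `(−∞, 0]`),
using the right-continuity of `F` (BV's cut points `q_j = min{x : F_c(x) = j}` are `G(j)`).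
[cite: BrouckeVindas2024, §2 (proof of Theorem 1.2)] -/
theorem exists_galois {F : StieltjesFunction ℝ} (h1 : F 1 = 0) (hF : Tendsto (fun x : ℝ ↦ F x) atTop atTop) :
    ∃ G : ℝ → ℝ, (∀ ⦃s : ℝ⦄, 0 < s → ∀ y : ℝ, G s ≤ y ↔ s ≤ F y) ∧ Monotone G ∧ ∀ s, 1 ≤ G s := by
  classical
  set G : ℝ → ℝ := fun s ↦ if 0 < s then sInf {y : ℝ | s ≤ F y} else 1 with hGdef
  have hne : ∀ s, {y : ℝ | s ≤ F y}.Nonempty := fun s ↦ (hF.eventually_ge_atTop s).exists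
  have hlt : ∀ {s y : ℝ}, 0 < s → s ≤ F y → 1 < y := fun {s y} hs hy ↦ by
    by_contra h
    have h2 : F y ≤ F 1 := F.mono (not_lt.1 h)
    rw [h1] at h2
    linarith
  have hbdd : ∀ {s : ℝ}, 0 < s → BddBelow {y : ℝ | s ≤ F y} := fun hs ↦ ⟨1, fun _ hy ↦ (hlt hs hy).le⟩
  -- `s ≤ F (G s)` by right-continuity
  have hmem : ∀ {s : ℝ}, 0 < s → s ≤ F (G s) := fun {s} hs ↦ by
    simp only [hGdef, if_pos hs]
    set S : Set ℝ := {y : ℝ | s ≤ F y}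
    have key : ∀ y, sInf S < y → s ≤ F y := fun y hy ↦ by
      obtain ⟨y', hy'S, hy'y⟩ := exists_lt_of_csInf_lt (hne s) hy
      exact le_trans hy'S (F.mono hy'y.le)
    have hc : Tendsto (fun x : ℝ ↦ F x) (𝓝[>] (sInf S)) (𝓝 (F (sInf S))) :=
      ((F.right_continuous (sInf S)).tendsto).mono_left (nhdsWithin_mono _ Ioi_subset_Ici_self)
    refine ge_of_tendsto hc ?_
    filter_upwards [self_mem_nhdsWithin] with y hy using key y hy
  have hgal : ∀ ⦃s : ℝ⦄, 0 < s → ∀ y : ℝ, G s ≤ y ↔ s ≤ F y := fun s hs y ↦ by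
    constructor
    · intro h
      exact (hmem hs).trans (F.mono h)
    · intro h
      simp only [hGdef, if_pos hs]
      exact csInf_le (hbdd hs) h
  have hone : ∀ s, 1 ≤ G s := fun s ↦ by
    by_cases hs : 0 < s
    · by_contra h
      have := (hgal hs 1).1 (not_le.1 h).le
      rw [h1] at this
      linarith
    · simp only [hGdef, if_neg hs, le_refl]
  refine ⟨G, hgal, fun s s' hss' ↦ ?_, hone⟩
  by_cases hs' : 0 < s'
  · by_cases hs : 0 < s
    · rw [hgal hs]
      exact hss'.trans (hmem hs')
    · have : G s = 1 := by simp only [hGdef, if_neg hs]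
      rw [this]
      exact hone s'
  · have hs : ¬0 < s := fun h ↦ hs' (h.trans_le hss')
    simp only [hGdef, if_neg hs, if_neg hs', le_refl]

end BrouckeVindas

end Literature.NumberTheory.BeurlingPrimes
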